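import Literature.MathematicalPhysics.QuantumFieldTheory.YangMillsOS
import HarnessLib

/-!
# `HypercubicLimit` — line `conditional-mean-telescoping`: the all-pairs clause of `GapData` feeds
# `HasLatticeMassGap r sch 1` verbatim (closure step (3), kernel-checked)

Support file for crux `stmt-QuantumFields-8646` (`HypercubicLimit`), refuter side (drefute gen 4).  The line's
imported IR input `stub_latticeGapInput : LatticeGapInput` supplies, for each compact simple `G`, a faithful `r`
and gap data `GapData G r β₁ C₁ c₂ m`; its clause (ii) is the 8901-shape ALL-PAIRS volume-uniform decay
`∀ A B : YMSpecies G, ∃ C S₀, ∀ β ≥ β₁, ∀ S ≥ S₀, ∀ n ≤ S, |latticeConnectedCorr r.ρ β (2S+1) A.F B.F n| ≤ C e^{−m(β) n}`,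
and the closure stub (`stub_closure`, step (3)) claims it gives the crux's uniform lattice gap
`HasLatticeMassGap r sch 1` "verbatim" along the scheme `a_k := m(β_k)`.  This file checks that claim against the
TREE definition of `HasLatticeMassGap` (Δ = 1, torus sides `2S+1 ≥ 2L_k+1`, `∀ᶠ k`): `hasLatticeMassGap_of_allPairsDecay`
— for ANY species scheme whose spacings are `a_k = m(β_k)` and whose couplings satisfy `β₁ ≤ β_k` eventually, clause (ii)
implies `HasLatticeMassGap r sch 1`; the only extra input is `L_k → ∞`, which every `SpeciesScheme` has
(`speciesScheme_tendsto_L`: `a_k L_k → ∞` with `0 < a_k → 0`).  So the IR socket of the line is typed compatibly with the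
crux's gap clause: no hidden reindexing, no constant loss, `S₀(A, B)` absorbed by `∀ᶠ k`.  (Drefute audit by-product;
the hypothesis is stated inline, no `def … : Prop` is introduced.)
-/

noncomputable section

open MeasureTheory Filter Topology
open Literature.MathematicalPhysics.AQFT Literature.MathematicalPhysics.QuantumLattice
open Literature.MathematicalPhysics.QuantumFieldTheory

namespace Summit.QuantumFields.YangMills.Theorems.HypercubicLimit.Negative

/-- **Along every species scheme the torus half-sides diverge**: `a_k L_k → ∞` with `0 < a_k → 0` forces
`L_k → ∞` (eventually `a_k ≤ 1`, so `L_k ≥ a_k L_k`). [folklore] -/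
theorem speciesScheme_tendsto_L {ι : Type} (sch : SpeciesScheme ι) :
    Tendsto (fun k => (sch.L k : ℝ)) atTop atTop := by
  have ha : ∀ᶠ k in atTop, sch.a k ≤ 1 :=
    (sch.tendsto_a.eventually (Iic_mem_nhds one_pos)).mono fun k hk => hk
  refine tendsto_atTop_mono' atTop ?_ sch.tendsto_L
  filter_upwards [ha] with k hk
  have hL : (0 : ℝ) ≤ sch.L k := Nat.cast_nonneg _
  calc sch.a k * sch.L k ≤ 1 * sch.L k := mul_le_mul_of_nonneg_right hk hL
    _ = sch.L k := one_mul _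

variable {G : Type} [Group G] [TopologicalSpace G] [IsTopologicalGroup G] [CompactSpace G]
  [MeasurableSpace G] [BorelSpace G]

/-- **The all-pairs clause (ii) of the line's `GapData` gives the crux's `HasLatticeMassGap r sch 1` verbatim** for
every species scheme with spacings `a_k = m(β_k)` and couplings eventually in `[β₁, ∞)`: for a pair of species take the
clause's `C`; eventually `L_k ≥ S₀(A, B)` (`speciesScheme_tendsto_L`), and then every torus of half-side `S ≥ L_k` and
every `n ≤ S` is covered, with `e^{−m(β_k) n} = e^{−1·(a_k n)}`. [folklore] -/
theorem hasLatticeMassGap_of_allPairsDecay (r : LatticeRep G) (β₁ : ℝ) (m : ℝ → ℝ)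
    (hii : ∀ A B : YMSpecies G, ∃ (C : ℝ) (S₀ : ℕ), ∀ β : ℝ, β₁ ≤ β → ∀ S : ℕ, S₀ ≤ S → ∀ n : ℕ, n ≤ S →
      |latticeConnectedCorr r.ρ β (2 * S + 1) A.F B.F n| ≤ C * Real.exp (-(m β * n)))
    (sch : SpeciesScheme (YMSpecies G)) (hβ : ∀ᶠ k in atTop, β₁ ≤ sch.β k)
    (ha : ∀ k, sch.a k = m (sch.β k)) :
    HasLatticeMassGap r sch 1 := by
  intro A B
  obtain ⟨C, S₀, h⟩ := hii A B
  refine ⟨C, ?_⟩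
  have hL : ∀ᶠ k in atTop, (S₀ : ℝ) ≤ sch.L k := (speciesScheme_tendsto_L sch).eventually_ge_atTop _
  filter_upwards [hβ, hL] with k hkβ hkL S hS n hn
  have hS₀ : S₀ ≤ S := by
    have h' : (S₀ : ℝ) ≤ (S : ℝ) := hkL.trans (by exact_mod_cast hS)
    exact_mod_cast h'
  have := h (sch.β k) hkβ S hS₀ n hn
  simpa [ha k, one_mul] using this


/-- **Clauses (i) + (ii) of the line's `GapData` alone inhabit the crux's uniform-lattice-gap conjunct with Δ = 1**:
from a rate function `m` positive on `[β₁, ∞)` with `m → 0` and the all-pairs decay (ii), the scheme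
`β_k := β₁ + k`, `a_k := m(β_k)`, `L_k := ⌈m(β_k)⁻²⌉₊` (so `a_k L_k ≥ 1/a_k → ∞`), `c ≡ m ≡ 0`, is a `SpeciesScheme` with
`HasLatticeMassGap r sch 1` — the closure's choice `a_k := m(β_k)` type-checks against the tree with no side condition
(any subsequence of `β_k` works the same way). [folklore] -/
theorem exists_scheme_hasLatticeMassGap (r : LatticeRep G) (β₁ : ℝ) (m : ℝ → ℝ)
    (hpos : ∀ β : ℝ, β₁ ≤ β → 0 < m β) (hlim : Tendsto m atTop (𝓝 0))
    (hii : ∀ A B : YMSpecies G, ∃ (C : ℝ) (S₀ : ℕ), ∀ β : ℝ, β₁ ≤ β → ∀ S : ℕ, S₀ ≤ S → ∀ n : ℕ, n ≤ S →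
      |latticeConnectedCorr r.ρ β (2 * S + 1) A.F B.F n| ≤ C * Real.exp (-(m β * n))) :
    ∃ sch : SpeciesScheme (YMSpecies G),
      (∀ k, sch.β k = β₁ + k) ∧ (∀ k, sch.a k = m (sch.β k)) ∧ HasLatticeMassGap r sch 1 := by
  have hβk : Tendsto (fun k : ℕ => β₁ + (k : ℝ)) atTop atTop :=
    tendsto_atTop_add_const_left _ _ tendsto_natCast_atTop_atTop
  have hak_pos : ∀ k : ℕ, 0 < m (β₁ + k) := fun k => hpos _ (by simp)
  have hak : Tendsto (fun k : ℕ => m (β₁ + k)) atTop (𝓝 0) := hlim.comp hβk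
  -- `1/a_k → ∞`
  have hinv : Tendsto (fun k : ℕ => (m (β₁ + k))⁻¹) atTop atTop := by
    have h' : Tendsto (fun k : ℕ => m (β₁ + k)) atTop (𝓝[>] 0) :=
      tendsto_nhdsWithin_iff.2 ⟨hak, Eventually.of_forall fun k => hak_pos k⟩
    exact tendsto_inv_nhdsGT_zero.comp h'
  -- `a_k L_k ≥ 1/a_k`
  have hL : Tendsto (fun k : ℕ => m (β₁ + k) * (⌈(m (β₁ + k))⁻¹ ^ 2⌉₊ : ℕ)) atTop atTop := by
    refine tendsto_atTop_mono (fun k => ?_) hinv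
    have ha := hak_pos k
    calc (m (β₁ + k))⁻¹ = m (β₁ + k) * (m (β₁ + k))⁻¹ ^ 2 := by field_simp
      _ ≤ m (β₁ + k) * (⌈(m (β₁ + k))⁻¹ ^ 2⌉₊ : ℕ) :=
          mul_le_mul_of_nonneg_left (Nat.le_ceil _) ha.le
  refine ⟨{ a := fun k => m (β₁ + k), a_pos := hak_pos, tendsto_a := hak, β := fun k => β₁ + k,
            L := fun k => ⌈(m (β₁ + k))⁻¹ ^ 2⌉₊, tendsto_L := hL, c := fun _ _ => 0, m := fun _ _ => 0 },
    fun k => rfl, fun k => rfl, ?_⟩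
  exact hasLatticeMassGap_of_allPairsDecay r β₁ m hii _ (Eventually.of_forall fun k => by simp) fun k => rfl

end Summit.QuantumFields.YangMills.Theorems.HypercubicLimit.Negative

end
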